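import Mathlib
import Summits.NavierStokesRegularity.NavierStokesRegularity.Theorems.TaoLadderRungTwoFlatCoMovingEnergyDecay
import Summits.NavierStokesRegularity.NavierStokesRegularity.Theorems.TaoLadderRungTwoFlatPulseSymmetry
import Summits.NavierStokesRegularity.NavierStokesRegularity.Theorems.TaoLadderRungTwoFlatPulseFlows
import HarnessLib

/-!
# The co-moving pulse template is an exact solution; the co-moving energy inequality along two global solutions of
  the homogeneous mirror lattice (λ₀ = 1 packaging of L8b-1) (helper for stmt-NavierStokesRegularity-23908
  `MirrorSolitaryWave`; route TaoLadderRungTwoFlat; cell harvest/h2-tao-ladder, p1 g21; LADDER §49.1/49.3)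

* `quadTermOn_shellShift_zero`, `isGlobalSol_shellShift`, `isGlobalSol_timeShift` — at scale ratio `1` the lattice is
  invariant under shell shifts and time shifts;
* `isGlobalSol_comovingPulse` — the template `MirrorPulse.comovingPulse κ Φ m t₀ : (i,n,t) ↦ κΦ_{i,n−m}(κ(t−t₀))` of
  theory-1's §49.1 IS an exact global solution whenever `Φ` is (scaling family + shifts), so the deviation
  `u = X − comovingPulse κ Φ m t₀` of a second global solution obeys `u̇ = Q(W+u) − Q(W)` exactly
  (`hasDerivAt_deviation_of_globalSol`);
* `coMovingEnergyOn_decay_of_globalSol` — `…CoMovingEnergyDecay.coMovingEnergyOn_decay_Icc` specialised to two global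
  solutions of `T♭(ε)` (flat clocks `c̄ = 1`), hypotheses reduced to the a-priori amplitude bounds and the edge input.

HONEST FRAMING: calculus about a MODEL lattice (Tao 2016 §4 vocabulary on `S♭`); the pulse and all bounds are
HYPOTHESES; nothing certified; nothing about the Navier–Stokes equations.
-/

noncomputable section

-- the sub-problem namespace repeats the summit name by design (D-0017)
set_option linter.dupNamespace false

namespace Summit.NavierStokesRegularity.NavierStokesRegularity.Theorems

open Set Filter Literature.Analysis.FluidPDE Literature.Analysis.FluidPDE.TaoCascade
open scoped Topology

namespace MirrorPulse

/-! ### Shell and time shifts at scale ratio 1 -/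

/-- At scale ratio `1` (`ε₀ = 0`) the field of a shell-shifted family is the shell-shifted field (any shift set, any
table). [cite: Tao2016AveragedNS, §4 (4.8); route TaoLadderRungTwoFlat, λ₀ = 1 layer] -/
theorem quadTermOn_shellShift_zero {m : ℕ} (𝕊 : Finset (ℤ × ℤ × ℤ)) (α : Fin m → Fin m → Fin m → ℤ × ℤ × ℤ → ℝ)
    (Φ : Fin m → ℤ → ℝ → ℝ) (d : ℤ) (i : Fin m) (n : ℤ) (t : ℝ) :
    quadTermOn 𝕊 0 α (fun j k s => Φ j (k - d) s) i n t = quadTermOn 𝕊 0 α Φ i (n - d) t := by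
  unfold quadTermOn
  refine Finset.sum_congr rfl fun i₁ _ => Finset.sum_congr rfl fun i₂ _ => Finset.sum_congr rfl fun μ _ => ?_
  simp only [add_zero, Real.one_rpow, mul_one]
  rw [show n - μ.2.2 + μ.1 - d = n - d - μ.2.2 + μ.1 by ring,
    show n - μ.2.2 + μ.2.1 - d = n - d - μ.2.2 + μ.2.1 by ring]

/-- Shell shifts of global solutions are global solutions (λ₀ = 1). [cite: Tao2016AveragedNS, §4 (4.8); route TaoLadderRungTwoFlat, λ₀ = 1 layer] -/
theorem isGlobalSol_shellShift {ε : ℝ} {Φ : Fin 2 → ℤ → ℝ → ℝ} (hΦ : IsGlobalSol ε Φ) (d : ℤ) :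
    IsGlobalSol ε (fun j k s => Φ j (k - d) s) := by
  intro i n t
  rw [quadTermOn_shellShift_zero]
  exact hΦ i (n - d) t

/-- Time shifts of global solutions are global solutions. [cite: Tao2016AveragedNS, §4 (4.8); route TaoLadderRungTwoFlat, λ₀ = 1 layer] -/
theorem isGlobalSol_timeShift {ε : ℝ} {Φ : Fin 2 → ℤ → ℝ → ℝ} (hΦ : IsGlobalSol ε Φ) (t₀ : ℝ) :
    IsGlobalSol ε (fun j k s => Φ j k (s - t₀)) := by
  intro i n t
  have hg : HasDerivAt (fun s : ℝ => s - t₀) 1 t := (hasDerivAt_id t).sub_const t₀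
  have h := (hΦ i n (t - t₀)).comp t hg
  rw [mul_one] at h
  exact h

/-- **The co-moving template is an exact solution**: for a global solution `Φ` of `T♭(ε)`, every member
`comovingPulse κ Φ m t₀` of its scaled/shifted family is a global solution. [cite: Tao2016AveragedNS, §4 (4.8),
§5–§6 (self-similar ansatz); route TaoLadderRungTwoFlat, L8b-1 template (LADDER §49.1)] -/
theorem isGlobalSol_comovingPulse {ε : ℝ} {Φ : Fin 2 → ℤ → ℝ → ℝ} (hΦ : IsGlobalSol ε Φ) (κ : ℝ) (m : ℤ)
    (t₀ : ℝ) : IsGlobalSol ε (comovingPulse κ Φ m t₀) := by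
  have h1 := isGlobalSol_shellShift hΦ m
  have h2 := isGlobalSol_scale h1 κ
  have h3 := isGlobalSol_timeShift h2 t₀
  have e : comovingPulse κ Φ m t₀ = fun j k s => FlowSymmetry.scaleFam κ (fun j k s => Φ j (k - m) s) j k (s - t₀) := by
    funext j k s; simp [comovingPulse, FlowSymmetry.scaleFam]
  rw [e]; exact h3

/-- The co-moving template inherits the pulse's sup bound, scaled by `|κ|`. [cite: Tao2016AveragedNS, §4 (4.5); route TaoLadderRungTwoFlat, L8b-1] -/
theorem abs_comovingPulse_le {Φ : Fin 2 → ℤ → ℝ → ℝ} {M : ℝ} (hΦb : ∀ i n t, |Φ i n t| ≤ M) (κ : ℝ) (m : ℤ)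
    (t₀ : ℝ) (i : Fin 2) (n : ℤ) (t : ℝ) : |comovingPulse κ Φ m t₀ i n t| ≤ |κ| * M := by
  unfold comovingPulse
  rw [abs_mul]
  exact mul_le_mul_of_nonneg_left (hΦb _ _ _) (abs_nonneg _)

/-- Along two global solutions `W`, `X` of `T♭(ε)` the deviation `u = X − W` satisfies `u̇ = Q(W+u) − Q(W)` at every
site and time. [cite: Tao2016AveragedNS, §4 (4.8); route TaoLadderRungTwoFlat, L8b-1] -/
theorem hasDerivAt_deviation_of_globalSol {ε : ℝ} {W X : Fin 2 → ℤ → ℝ → ℝ} (hW : IsGlobalSol ε W)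
    (hX : IsGlobalSol ε X) (i : Fin 2) (n : ℤ) (t : ℝ) :
    HasDerivAt ((X - W) i n) (quadTermOn shiftSetFlat 0 (mirrorTable ε ε) (W + (X - W)) i n t
      - quadTermOn shiftSetFlat 0 (mirrorTable ε ε) W i n t) t := by
  have e : W + (X - W) = X := by abel
  rw [e]
  have h := (hX i n t).sub (hW i n t)
  have hfun : (X i n - W i n) = (X - W) i n := by funext s; simp
  rw [hfun] at h
  exact h

/-! ### L8b-1 along two global solutions (flat clocks) -/

/-- **CO-MOVING ENERGY DECAY ALONG TWO GLOBAL SOLUTIONS (λ₀ = 1).** `W`, `X` global solutions of `T♭(ε)` (`0 ≤ ε`),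
`u = X − W`, block `[a,P]`, edge `n_e(t) = n₀ + σt`, `0 ≤ θ`; on `(t₁,t₂)`: `|u| ≤ A` and `|W| ≤ M` on shells `a−1 … P+1`
and the edge input `≤ Ē`; any `0 < μ ≤ σθ − 2(1+ε)(A sinh(θ/2) + M(3+e^θ))`. Then
`V_{[a,P]}(t₂) ≤ e^{−μ(t₂−t₁)}V_{[a,P]}(t₁) + Ē(1 − e^{−μ(t₂−t₁)})/μ`. (Template = `comovingPulse κ Φ m t₀` by
`isGlobalSol_comovingPulse`.) [cite: Tao2016AveragedNS, §4 (4.3), (4.8); route TaoLadderRungTwoFlat, L8b-1 (LADDER §49.3)] -/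
theorem coMovingEnergyOn_decay_of_globalSol {ε θ σ n₀ A M μ Ebar t₁ t₂ : ℝ} (hε : 0 ≤ ε) (hθ : 0 ≤ θ)
    {a P : ℤ} (haP : a ≤ P) (ht : t₁ ≤ t₂) {W X : Fin 2 → ℤ → ℝ → ℝ} (hW : IsGlobalSol ε W) (hX : IsGlobalSol ε X)
    (hA : ∀ t ∈ Ioo t₁ t₂, ∀ i, ∀ n ∈ Finset.Icc (a - 1) (P + 1), |(X - W) i n t| ≤ A)
    (hM : ∀ t ∈ Ioo t₁ t₂, ∀ i, ∀ n ∈ Finset.Icc (a - 1) (P + 1), |W i n t| ≤ M)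
    (hE : ∀ t ∈ Ioo t₁ t₂,
      Real.exp (θ * ((a : ℝ) - (n₀ + σ * t))) * |fluxT ε 0 (X - W) (a - 1) t|
        + Real.exp (θ * ((P : ℝ) - (n₀ + σ * t))) * |fluxT ε 0 (X - W) P t|
        + (1 + ε) * 1 * M * (Real.exp (θ * ((a : ℝ) - (n₀ + σ * t))) * (X - W) 1 (a - 1) t ^ 2
            + Real.exp (θ * ((P : ℝ) - (n₀ + σ * t))) * (X - W) 0 (P + 1) t ^ 2) ≤ Ebar)
    (hμ : 0 < μ) (hμle : μ ≤ σ * θ - 2 * (1 + ε) * 1 * (A * Real.sinh (θ / 2) + M * (3 + Real.exp θ))) :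
    coMovingEnergyOn (Finset.Icc a P) θ (n₀ + σ * t₂) (X - W) t₂
      ≤ Real.exp (-μ * (t₂ - t₁)) * coMovingEnergyOn (Finset.Icc a P) θ (n₀ + σ * t₁) (X - W) t₁
        + Ebar * (1 - Real.exp (-μ * (t₂ - t₁))) / μ := by
  have hcont : ∀ i, ∀ n ∈ Finset.Icc a P, ContinuousOn ((X - W) i n) (Icc t₁ t₂) := fun i n _ => by
    have h : Continuous fun s => X i n s - W i n s := (hX.continuous i n).sub (hW.continuous i n)
    have e : (X - W) i n = fun s => X i n s - W i n s := by funext s; simp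
    rw [e]; exact h.continuousOn
  have hder : ∀ t ∈ Ioo t₁ t₂, ∀ i, ∀ n ∈ Finset.Icc a P,
      HasDerivAt ((X - W) i n) (quadTermOn shiftSetFlat 0 (mirrorTable ε ε) (W + (X - W)) i n t
        - quadTermOn shiftSetFlat 0 (mirrorTable ε ε) W i n t) t :=
    fun t _ i n _ => hasDerivAt_deviation_of_globalSol hW hX i n t
  have hc : ∀ n ∈ Finset.Icc (a - 1) P, clock 0 n ≤ 1 := fun n _ => (clock_zero n).le
  exact coMovingEnergyOn_decay_Icc hε (by norm_num) hθ haP ht hcont hder hA hM hc hE hμ hμle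

end MirrorPulse

end Summit.NavierStokesRegularity.NavierStokesRegularity.Theorems

end
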